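import Mathlib.LinearAlgebra.Matrix.PosDef
import Mathlib.LinearAlgebra.Matrix.SchurComplement
import Mathlib.Algebra.Order.Star.Real
import HarnessLib

/-!
# HANDOFF — the DRESSED BLOCK (Feshbach / Schur complement), exactly: a two-block symmetric form is non-negative iff its Schur complement onto the first block is, and a null vector's second block is the resolvent response to its first (cell rh-explicit, TRACK «HANDOFF», seat theory-2 gen8, file XII-v)

HONEST FRAMING. Nothing here bears on the truth of RH. This is linear algebra over `ℝ` (Mathlib's Schur complement), recorded because it is the exact
frame of the cell's MECHANISM II «with the bulk»: write a section of the deleted Weil form `Q_{S_q} = Q − N` in the coordinates «near-null modes of the full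
form ⊕ bulk modes» as a block matrix `M = [[A, B], [Bᵀ, D]]` with `D ≻ 0` (the bulk block, gapped). Then

* `posSemidef_fromBlocks_iff_dressed`: **`M ⪰ 0 ↔ A − B D⁻¹ Bᵀ ⪰ 0`** — the WALL is where the DRESSED near-null block `A − B D⁻¹ Bᵀ` (the near-null block of
  `Q − N` corrected by the bulk's resolvent response) loses positivity; the undressed block `A` (idea-1's tower model (TW) / cc-s2-6's near-null pencil) is
  only an upper bound (`posSemidef_dressed_le`: `A − BD⁻¹Bᵀ ⪯ A`, so `A − BD⁻¹Bᵀ ⪰ 0 → A ⪰ 0`, not conversely);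
* `fromBlocks_mulVec_eq_zero_iff`: **`M (v₁ ⊕ v₂) = 0 ↔ v₂ = −D⁻¹Bᵀ v₁ ∧ (A − B D⁻¹ Bᵀ) v₁ = 0`** — a null vector (the wall vector) is determined by its
  near-null part, its bulk part being the RESOLVENT RESPONSE `−D⁻¹Bᵀv₁` (EDGESIGN REPORT §4f: at q = 5 this bulk part carries ≈ 90 % of the even wall vector's
  negative edge lobe and places its node);
* `dotProduct_fromBlocks_ge_dressed` / `dotProduct_fromBlocks_eq_dressed_of_response`: for fixed `v₁` the form `⟨v, Mv⟩` over `v = v₁ ⊕ v₂` is minimised exactly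
  at the response `v₂ = −D⁻¹Bᵀv₁`, with minimum `⟨v₁, (A − BD⁻¹Bᵀ)v₁⟩` (completion of the square) — «dressing = minimising out the bulk».

References: [folklore] (Schur complement / Feshbach map; e.g. F. Zhang (ed.), The Schur Complement and Its Applications, Springer 2005, Thm 1.12); the
cell's use: HOME/handoff/theory-2/edgesign/REPORT.md §4f, IDEAS-prolate §44 (TW), HPWALLS-cc6 §9.3 (MECHANISM II).
-/

set_option linter.dupNamespace false

namespace Summit.RiemannHypothesis.RiemannHypothesis.Theorems.HandoffFeshbachBlock

open Matrix

variable {m n : Type*} [Fintype m] [Fintype n] [DecidableEq n]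
variable {A : Matrix m m ℝ} {B : Matrix m n ℝ} {D : Matrix n n ℝ}

omit [Fintype m] [Fintype n] [DecidableEq n] in
/-- Over `ℝ` the conjugate transpose is the transpose. [folklore] -/
theorem conjTranspose_real (B : Matrix m n ℝ) : Bᴴ = Bᵀ := by
  ext i j; simp [conjTranspose_apply]

omit [Fintype m] in
/-- A positive definite real matrix times its inverse: `D (D⁻¹ w) = w`. [folklore] -/
theorem mulVec_inv_mulVec (hD : D.PosDef) (w : n → ℝ) : D *ᵥ (D⁻¹ *ᵥ w) = w := by
  rw [mulVec_mulVec, mul_nonsing_inv _ ((isUnit_iff_isUnit_det _).1 hD.isUnit), one_mulVec]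

omit [Fintype m] in
/-- … and `D⁻¹ (D w) = w`. [folklore] -/
theorem inv_mulVec_mulVec (hD : D.PosDef) (w : n → ℝ) : D⁻¹ *ᵥ (D *ᵥ w) = w := by
  rw [mulVec_mulVec, nonsing_inv_mul _ ((isUnit_iff_isUnit_det _).1 hD.isUnit), one_mulVec]

omit [Fintype m] [DecidableEq n] in
/-- The `D`-form is non-negative for `D ≻ 0`. [folklore] -/
theorem dotProduct_mulVec_nonneg (hD : D.PosDef) (y : n → ℝ) : 0 ≤ y ⬝ᵥ (D *ᵥ y) := by
  simpa using (posSemidef_iff_dotProduct_mulVec.mp hD.posSemidef).2 y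

omit [Fintype m] in
/-- The resolvent form `⟨y, D⁻¹y⟩` is non-negative for `D ≻ 0`. [folklore] -/
theorem dotProduct_inv_mulVec_nonneg (hD : D.PosDef) (y : n → ℝ) : 0 ≤ y ⬝ᵥ (D⁻¹ *ᵥ y) := by
  simpa using (posSemidef_iff_dotProduct_mulVec.mp hD.inv.posSemidef).2 y

omit [Fintype m] [Fintype n] [DecidableEq n] in
/-- `Sum.elim a b = 0 ↔ a = 0 ∧ b = 0`. [folklore] -/
theorem sumElim_eq_zero_iff (a : m → ℝ) (b : n → ℝ) : Sum.elim a b = 0 ↔ a = 0 ∧ b = 0 := by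
  constructor
  · intro h
    exact ⟨funext fun i ↦ by simpa using congrFun h (Sum.inl i), funext fun j ↦ by simpa using congrFun h (Sum.inr j)⟩
  · rintro ⟨rfl, rfl⟩
    funext i; cases i <;> rfl

omit [DecidableEq n] in
/-- `x·(B y) = (Bᵀx)·y`. [folklore] -/
theorem dotProduct_mulVec_eq_transpose (x : m → ℝ) (y : n → ℝ) : x ⬝ᵥ (B *ᵥ y) = (Bᵀ *ᵥ x) ⬝ᵥ y := by
  rw [dotProduct_mulVec, mulVec_transpose]

/-! ## §1 The wall is where the DRESSED block loses positivity -/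

/-- **Schur complement criterion (real form)**: for `D ≻ 0`, `[[A, B], [Bᵀ, D]] ⪰ 0 ↔ A − B D⁻¹ Bᵀ ⪰ 0`. [folklore] -/
theorem posSemidef_fromBlocks_iff_dressed (hD : D.PosDef) :
    (fromBlocks A B Bᵀ D).PosSemidef ↔ (A - B * D⁻¹ * Bᵀ).PosSemidef := by
  letI : Invertible D := hD.isUnit.invertible
  have h := Matrix.PosDef.fromBlocks₂₂ A B hD
  rwa [conjTranspose_real] at h

/-- The dressing only LOWERS the block: `⟨x, (A − BD⁻¹Bᵀ)x⟩ ≤ ⟨x, Ax⟩` (the correction `⟨Bᵀx, D⁻¹Bᵀx⟩` is `≥ 0`). So positivity of the undressed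
near-null block `A` is necessary, not sufficient, for the wall not to have been passed. [folklore] -/
theorem dotProduct_dressed_le (hD : D.PosDef) (x : m → ℝ) :
    x ⬝ᵥ ((A - B * D⁻¹ * Bᵀ) *ᵥ x) ≤ x ⬝ᵥ (A *ᵥ x) := by
  have hcorr : 0 ≤ (Bᵀ *ᵥ x) ⬝ᵥ (D⁻¹ *ᵥ (Bᵀ *ᵥ x)) := dotProduct_inv_mulVec_nonneg hD _
  have e : x ⬝ᵥ ((A - B * D⁻¹ * Bᵀ) *ᵥ x) = x ⬝ᵥ (A *ᵥ x) - (Bᵀ *ᵥ x) ⬝ᵥ (D⁻¹ *ᵥ (Bᵀ *ᵥ x)) := by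
    rw [sub_mulVec, dotProduct_sub, Matrix.mul_assoc, ← mulVec_mulVec, ← mulVec_mulVec, dotProduct_mulVec_eq_transpose (B := B)]
  rw [e]; linarith

/-- Hence `A − BD⁻¹Bᵀ ⪰ 0 → A ⪰ 0` (for symmetric `A`): the tower model's undressed wall is never EARLIER than the true wall. [folklore] -/
theorem posSemidef_of_dressed (hD : D.PosDef) (hA : A.IsHermitian) (h : (A - B * D⁻¹ * Bᵀ).PosSemidef) : A.PosSemidef := by
  refine PosSemidef.of_dotProduct_mulVec_nonneg hA fun x ↦ ?_
  have h1 := (posSemidef_iff_dotProduct_mulVec.mp h).2 x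
  simp only [star_trivial] at h1 ⊢
  exact h1.trans (dotProduct_dressed_le hD x)

/-! ## §2 A null vector's bulk part is the resolvent response to its near-null part -/

/-- **Feshbach for a null vector**: with `D ≻ 0`, `[[A, B], [Bᵀ, D]] (v₁ ⊕ v₂) = 0 ↔ v₂ = −D⁻¹Bᵀv₁ ∧ (A − BD⁻¹Bᵀ) v₁ = 0`. [folklore] -/
theorem fromBlocks_mulVec_eq_zero_iff (hD : D.PosDef) (v₁ : m → ℝ) (v₂ : n → ℝ) :
    (fromBlocks A B Bᵀ D) *ᵥ Sum.elim v₁ v₂ = 0 ↔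
      v₂ = -(D⁻¹ *ᵥ (Bᵀ *ᵥ v₁)) ∧ (A - B * D⁻¹ * Bᵀ) *ᵥ v₁ = 0 := by
  rw [fromBlocks_mulVec]
  simp only [Sum.elim_comp_inl, Sum.elim_comp_inr]
  rw [sumElim_eq_zero_iff]
  constructor
  · rintro ⟨h1, h2⟩
    have hv2 : v₂ = -(D⁻¹ *ᵥ (Bᵀ *ᵥ v₁)) := by
      have : D *ᵥ v₂ = -(Bᵀ *ᵥ v₁) := eq_neg_of_add_eq_zero_right h2
      calc v₂ = D⁻¹ *ᵥ (D *ᵥ v₂) := (inv_mulVec_mulVec hD v₂).symm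
        _ = -(D⁻¹ *ᵥ (Bᵀ *ᵥ v₁)) := by rw [this, mulVec_neg]
    refine ⟨hv2, ?_⟩
    rw [hv2, mulVec_neg] at h1
    rw [sub_mulVec, Matrix.mul_assoc, ← mulVec_mulVec, ← mulVec_mulVec]
    rwa [← sub_eq_add_neg] at h1
  · rintro ⟨hv2, h1⟩
    refine ⟨?_, ?_⟩
    · rw [hv2, mulVec_neg, ← sub_eq_add_neg]
      rwa [sub_mulVec, Matrix.mul_assoc, ← mulVec_mulVec, ← mulVec_mulVec] at h1
    · rw [hv2, mulVec_neg, mulVec_inv_mulVec hD, add_neg_cancel]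

/-- So a null vector of the dressed block EXTENDS to a null vector of the whole form by the response `v₂ = −D⁻¹Bᵀv₁` (and only so). [folklore] -/
theorem fromBlocks_mulVec_response_eq_zero (hD : D.PosDef) {v₁ : m → ℝ} (h : (A - B * D⁻¹ * Bᵀ) *ᵥ v₁ = 0) :
    (fromBlocks A B Bᵀ D) *ᵥ Sum.elim v₁ (-(D⁻¹ *ᵥ (Bᵀ *ᵥ v₁))) = 0 :=
  (fromBlocks_mulVec_eq_zero_iff hD v₁ _).2 ⟨rfl, h⟩

/-! ## §3 Dressing = minimising out the bulk (completion of the square) -/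

/-- **Completion of the square**: `⟨v₁ ⊕ v₂, M(v₁ ⊕ v₂)⟩ = ⟨v₁, (A − BD⁻¹Bᵀ)v₁⟩ + ⟨r, D r⟩` with `r = D⁻¹Bᵀv₁ + v₂` (Mathlib's `schur_complement_eq₂₂`, real form).
[folklore] -/
theorem dotProduct_fromBlocks_eq (hD : D.PosDef) (v₁ : m → ℝ) (v₂ : n → ℝ) :
    Sum.elim v₁ v₂ ⬝ᵥ ((fromBlocks A B Bᵀ D) *ᵥ Sum.elim v₁ v₂) =
      v₁ ⬝ᵥ ((A - B * D⁻¹ * Bᵀ) *ᵥ v₁) +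
        (D⁻¹ *ᵥ (Bᵀ *ᵥ v₁) + v₂) ⬝ᵥ (D *ᵥ (D⁻¹ *ᵥ (Bᵀ *ᵥ v₁) + v₂)) := by
  letI : Invertible D := hD.isUnit.invertible
  have h := schur_complement_eq₂₂ A B v₁ v₂ hD.1
  simp only [star_trivial, conjTranspose_real, dotProduct_mulVec] at h ⊢
  rw [show (Sum.elim v₁ v₂ : m ⊕ n → ℝ) = v₁ ⊕ᵥ v₂ from rfl] at *
  rw [h, ← mulVec_mulVec, add_comm]

/-- **The dressed value is a lower bound**: `⟨v₁, (A − BD⁻¹Bᵀ)v₁⟩ ≤ ⟨v₁ ⊕ v₂, M(v₁ ⊕ v₂)⟩` for every bulk component `v₂`. [folklore] -/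
theorem dotProduct_fromBlocks_ge_dressed (hD : D.PosDef) (v₁ : m → ℝ) (v₂ : n → ℝ) :
    v₁ ⬝ᵥ ((A - B * D⁻¹ * Bᵀ) *ᵥ v₁) ≤ Sum.elim v₁ v₂ ⬝ᵥ ((fromBlocks A B Bᵀ D) *ᵥ Sum.elim v₁ v₂) := by
  rw [dotProduct_fromBlocks_eq hD]
  have h := dotProduct_mulVec_nonneg hD (D⁻¹ *ᵥ (Bᵀ *ᵥ v₁) + v₂)
  linarith

/-- **… attained at the response**: with `v₂ = −D⁻¹Bᵀv₁` the form equals the dressed value `⟨v₁, (A − BD⁻¹Bᵀ)v₁⟩`. [folklore] -/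
theorem dotProduct_fromBlocks_eq_dressed_of_response (hD : D.PosDef) (v₁ : m → ℝ) :
    Sum.elim v₁ (-(D⁻¹ *ᵥ (Bᵀ *ᵥ v₁))) ⬝ᵥ ((fromBlocks A B Bᵀ D) *ᵥ Sum.elim v₁ (-(D⁻¹ *ᵥ (Bᵀ *ᵥ v₁)))) =
      v₁ ⬝ᵥ ((A - B * D⁻¹ * Bᵀ) *ᵥ v₁) := by
  rw [dotProduct_fromBlocks_eq hD, add_neg_cancel, mulVec_zero, dotProduct_zero, add_zero]

end Summit.RiemannHypothesis.RiemannHypothesis.Theorems.HandoffFeshbachBlock
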